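import Summits.QuantumFields.QCD.Theorems.SpectralDefectExtinctionChiralDescentStubTorusFunctionalPolynomialInMass
import Literature.MathematicalPhysics.QuantumFieldTheory.QCDOS
import Literature.MathematicalPhysics.QuantumFieldTheory.QCDPhaseQuenched
import Literature.MathematicalPhysics.QuantumFieldTheory.QCDSiteReflectionPositivityProofs
import Literature.MathematicalPhysics.QuantumLattice.GrassmannCoefficientRegularity
import Literature.MathematicalPhysics.QuantumLattice.SchwartzTensor
import Literature.MathematicalPhysics.QuantumLattice.RandomField
import Literature.MathematicalPhysics.AQFT.OSAxiomsSchwinger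
import HarnessLib

/-!
# The lattice `n`-point DISTRIBUTION of lattice QCD and its agreement with `qcdLatticeSchwinger`

Proof-side definitions for crux `StableActionBridge` (stmt-QuantumFields-9737), line `Sketch` (reshape r3),
task T0 (route-posited proof-side objects; D-0016 `<RouteSlug>Defs` file).

The tree's `qcdLatticeSchwinger sch k n σ f` is a NUMBER attached to an `n`-tuple of REAL one-point test
functions; OS data are continuous linear functionals on `𝓢((ℝ⁴)ⁿ, ℂ)`.  The bridge is the finite atomic functional
  `qcdLatticeDist sch k n σ : 𝓢((Fin n → ℝ⁴), ℂ) →L[ℂ] ℂ`,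
  `F ↦ ∑_{x ∈ (box L_k)ⁿ} W_σ(x) · F(a_k x₁, …, a_k xₙ)` (`n ≥ 1`; in degree `0` it is point evaluation,
so it is normalised whatever the torus denominator is), with the weights
  `W_σ(x) = ∫dμ_W(U) ∫dψ̄dψ (∏ᵢ z_{σᵢ}(k) a_k⁴ (O_{σᵢ}(xᵢ) − shift_{σᵢ}(k))) e^{−ψ̄D(U)ψ} / ∫dμ_W(U) ∫dψ̄dψ e^{−ψ̄D(U)ψ}`
(`qcdTorusMomentStr`: the honest expectation of the ORDERED product of the renormalised centred insertions
`renormInsertion`).  Contents (everything proved, no named fact):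
* bookkeeping in a noncommutative semiring: `sum_piFinset_succ`, `prod_ofFn_finset_sum` (an ordered product of
  finite sums is the sum over `Fintype.piFinset` of the ordered products), `prod_ofFn_smul` (scalars pull out);
* regularity: `coeffRegular_insertion`, `coeffRegular_renormInsertion`, `coeffRegular_prod_ofFn`,
  `coeffRegular_qcdBoltzmann`, `integrable_fermiIntegral_prod_renormInsertion` (via the landed
  `ChiralDescent.InfimumDescent.integrable_apply_of_coeffRegular`) — every
  `U ↦ ∫dψ̄dψ (∏ᵢ insertions) e^{−ψ̄D(U)ψ}` is bounded and measurable coefficientwise (tree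
  `GrassmannCoefficientRegularity`), hence integrable against the Wilson probability measure;
* `renormInsertion`, `smearedInsertion_eq_sum_smul_renormInsertion`, `qcdTorusMomentStr`, `qcdLatticeDist`,
  `qcdLatticeDist_zero_apply`, `qcdLatticeDist_apply`;
* `qcdLatticeSchwinger_eq_qcdLatticeDist`: on a tensor `F = f₁ ⊗ ⋯ ⊗ fₙ` of real test functions, `n ≥ 1`,
  `qcdLatticeDist sch k n σ F = qcdLatticeSchwinger sch k n σ f`.
Model: the commutative Yang–Mills analogue `YangMills/Theorems/…StubAssemblyLatticeDist.lean` (`latticeDist`,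
`latticeSchwinger_eq_latticeDist`).  References: Glimm–Jaffe 1987 §6.1; Osterwalder–Schrader 1973 §2;
Osterwalder–Seiler 1978 §2; Montvay–Münster 1994 §4.1, §5.1.
-/

noncomputable section

open scoped SchwartzMap BigOperators
open MeasureTheory Filter Topology
open Literature.MathematicalPhysics.QuantumFieldTheory Literature.MathematicalPhysics.QuantumLattice
open Literature.MathematicalPhysics.QuantumLattice.GrassmannAlgebra
open Literature.MathematicalPhysics.AQFT
open Literature.Probability.LatticeModels (box Site)

namespace Summit.QuantumFields.QCD.Cruxes.StableActionBridge.Sketch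

/-! ### Bookkeeping: ordered products of finite sums -/

/-- Summing over `(n+1)`-tuples from `s` is summing over the head and over the `n`-tuple tail (`Fin.cons`). -/
theorem sum_piFinset_succ {α M : Type*} [AddCommMonoid M] {n : ℕ} (s : Finset α)
    (g : (Fin (n + 1) → α) → M) :
    ∑ x ∈ Fintype.piFinset (fun _ : Fin (n + 1) => s), g x =
      ∑ a ∈ s, ∑ y ∈ Fintype.piFinset (fun _ : Fin n => s), g (Fin.cons a y) := by
  classical
  rw [← Finset.sum_product']
  refine Finset.sum_bij' (fun x _ => (x 0, Fin.tail x)) (fun p _ => Fin.cons p.1 p.2) (fun x hx => ?_)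
    (fun p hp => ?_) (fun x _ => Fin.cons_self_tail x) (fun p _ => ?_) (fun x _ => by rw [Fin.cons_self_tail])
  · simp only [Finset.mem_product, Fintype.mem_piFinset] at hx ⊢
    exact ⟨hx 0, fun i => hx i.succ⟩
  · simp only [Finset.mem_product, Fintype.mem_piFinset] at hp ⊢
    refine Fin.cases ?_ (fun i => ?_)
    · simpa only [Fin.cons_zero] using hp.1
    · simpa only [Fin.cons_succ] using hp.2 i
  · simp only [Fin.cons_zero, Fin.tail_cons, Prod.mk.eta]

/-- **An ordered product of finite sums is the sum over tuples of the ordered products** (noncommutative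
semiring; the commutative `Finset.prod_univ_sum` is not available in the Grassmann algebra). -/
theorem prod_ofFn_finset_sum {R α : Type*} [Semiring R] (s : Finset α) :
    ∀ {n : ℕ} (g : Fin n → α → R),
      (List.ofFn fun i => ∑ a ∈ s, g i a).prod =
        ∑ x ∈ Fintype.piFinset (fun _ : Fin n => s), (List.ofFn fun i => g i (x i)).prod
  | 0, g => by simp [Fintype.piFinset_of_isEmpty]
  | n + 1, g => by
    rw [sum_piFinset_succ, List.ofFn_succ, List.prod_cons, prod_ofFn_finset_sum s fun i => g i.succ,
      Finset.sum_mul_sum]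
    refine Finset.sum_congr rfl fun a _ => Finset.sum_congr rfl fun y _ => ?_
    rw [List.ofFn_succ, List.prod_cons]
    simp only [Fin.cons_zero, Fin.cons_succ]

/-- Scalars pull out of an ordered product: `∏ᵢ (cᵢ • Xᵢ) = (∏ᵢ cᵢ) • ∏ᵢ Xᵢ` (ordered products, commutative scalars). -/
theorem prod_ofFn_smul {R A : Type*} [CommSemiring R] [Semiring A] [Algebra R A] :
    ∀ {n : ℕ} (c : Fin n → R) (X : Fin n → A),
      (List.ofFn fun i => c i • X i).prod = (∏ i, c i) • (List.ofFn X).prod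
  | 0, c, X => by simp
  | n + 1, c, X => by
    rw [List.ofFn_succ, List.prod_cons, prod_ofFn_smul (fun i => c i.succ) (fun i => X i.succ),
      Fin.prod_univ_succ, List.ofFn_succ, List.prod_cons, smul_mul_smul_comm]

/-! ### Coefficient regularity and integrability of the Berezin integrands -/

section Regularity

variable {Nf L : ℕ} [NeZero L]

/-- The lattice insertion of every species at every site is coefficient-regular in the gauge field (the glue
density is continuous in the links; the meson bilinears do not depend on them). -/
theorem coeffRegular_insertion (s : QCDField Nf) (y : Site 4) :
    CoeffRegular (fun U : GaugeConfig 4 L (Matrix.specialUnitaryGroup (Fin 3) ℂ) => insertion U s y) := by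
  cases s with
  | glue =>
    simp only [insertion, Algebra.algebraMap_eq_smul_one]
    have hT : Continuous (torusLift (d := 4) (G := (Matrix.specialUnitaryGroup (Fin 3) ℂ)) L) := by unfold torusLift; fun_prop
    exact coeffRegular_smul_const (Complex.continuous_ofReal.comp
      ((continuous_actionDensity (continuous_fundamentalRep (Fin 3))).comp
        ((continuous_configShift _).comp hT))) 1
  | pseudoRe f g =>
    simp only [insertion]
    exact coeffRegular_const _
  | pseudoIm f g =>
    simp only [insertion]
    exact coeffRegular_const _

/-- Ordered products of coefficient-regular Grassmann-valued variables are coefficient-regular. -/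
theorem coeffRegular_prod_ofFn {Ω : Type*} [MeasurableSpace Ω] {ι : Type*} [LinearOrder ι] [Fintype ι] {n : ℕ}
    {X : Fin n → Ω → GrassmannAlgebra ℂ ι} (hX : ∀ i, CoeffRegular (X i)) :
    CoeffRegular (fun ω => (List.ofFn fun i => X i ω).prod) := by
  have he : (fun ω => (List.ofFn fun i => X i ω).prod) = fun ω => ((List.finRange n).map fun i => X i ω).prod :=
    funext fun ω => by rw [List.ofFn_eq_map]
  rw [he]
  exact CoeffRegular.list_prod (List.finRange n) fun i _ => hX i

/-- The fermionic Boltzmann factor `U ↦ e^{−ψ̄D(U,m)ψ}` is coefficient-regular: the entries of `D(U, m)` are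
continuous in `U` and a quadratic form has no constant term. -/
theorem coeffRegular_qcdBoltzmann (mq : Fin Nf → ℝ) :
    CoeffRegular (fun U : GaugeConfig 4 L (Matrix.specialUnitaryGroup (Fin 3) ℂ) => fermiBoltzmann U mq) := by
  unfold fermiBoltzmann
  exact (coeffRegular_quadratic fun p q =>
    (continuous_diracMatrix mq).neg.matrix_elem p q).grassmannExp fun U => coord_empty_quadratic _

end Regularity

/-! ### The weights and the distribution -/

variable {Nf : ℕ}

/-- **The renormalised centred insertion** of species `s` at the site `y ∈ ℤ⁴` at step `k`, as an (even) Grassmann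
element depending on the gauge field: `z_s(k) a_k⁴ (O_s(y) − shift_s(k))` — the summand of the tree's
`smearedInsertion` stripped of the test function. -/
def renormInsertion (sch : QCDScheme Nf) (k : ℕ) (s : QCDField Nf) (y : Site 4)
    (U : GaugeConfig 4 (sch.side k) (Matrix.specialUnitaryGroup (Fin 3) ℂ)) : FermiAlg Nf (sch.side k) :=
  ((sch.z s k * sch.a k ^ 4 : ℝ) : ℂ) • (insertion U s y - algebraMap ℂ _ ((sch.shift s k : ℝ) : ℂ))

/-- The tree's smeared insertion is the test-function-weighted sum of the renormalised centred insertions: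
`Φ_k^s(f)(U) = ∑_{y ∈ box} f(a_k y) • renormInsertion sch k s y U`. -/
theorem smearedInsertion_eq_sum_smul_renormInsertion (sch : QCDScheme Nf) (k : ℕ)
    (U : GaugeConfig 4 (sch.side k) (Matrix.specialUnitaryGroup (Fin 3) ℂ)) (s : QCDField Nf) (f : 𝓢(EuclideanSpace ℝ (Fin 4), ℝ)) :
    smearedInsertion sch k U s f =
      ∑ y ∈ box 4 (sch.L k), ((f (sch.a k • siteToE y) : ℝ) : ℂ) • renormInsertion sch k s y U := by
  unfold smearedInsertion renormInsertion
  refine Finset.sum_congr rfl fun y _ => ?_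
  rw [smul_smul]
  congr 1
  push_cast
  ring

/-- The renormalised centred insertion is coefficient-regular in the gauge field. -/
theorem coeffRegular_renormInsertion (sch : QCDScheme Nf) (k : ℕ) (s : QCDField Nf) (y : Site 4) :
    CoeffRegular (fun U : GaugeConfig 4 (sch.side k) (Matrix.specialUnitaryGroup (Fin 3) ℂ) => renormInsertion sch k s y U) := by
  have h := ((coeffRegular_insertion (L := sch.side k) s y).add
    (coeffRegular_const (Ω := GaugeConfig 4 (sch.side k) (Matrix.specialUnitaryGroup (Fin 3) ℂ))
      (-(algebraMap ℂ (FermiAlg Nf (sch.side k)) ((sch.shift s k : ℝ) : ℂ))))).const_smul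
    ((sch.z s k * sch.a k ^ 4 : ℝ) : ℂ)
  simpa only [renormInsertion, sub_eq_add_neg] using h

/-- **Integrability of the Berezin integrands.** For every string of species `σ` and every tuple of sites `x`,
`U ↦ ∫dψ̄dψ (∏ᵢ renormInsertion (σ i) (x i) U) e^{−ψ̄D(U)ψ}` (ordered product) is integrable against the Wilson
gauge measure of the scheme (bounded and measurable on a probability space). -/
theorem integrable_fermiIntegral_prod_renormInsertion (sch : QCDScheme Nf) (k : ℕ) {n : ℕ}
    (σ : Fin n → QCDField Nf) (x : Fin n → Site 4) :
    Integrable (fun U : GaugeConfig 4 (sch.side k) (Matrix.specialUnitaryGroup (Fin 3) ℂ) =>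
      fermiIntegral ((List.ofFn fun i => renormInsertion sch k (σ i) (x i) U).prod *
        fermiBoltzmann U fun fl => sch.mq fl k)) (qcdGaugeMeasure sch k) := by
  haveI : IsProbabilityMeasure (qcdGaugeMeasure sch k) := isProbabilityMeasure_wilsonMeasure_fundamental _
  exact Summit.QuantumFields.QCD.Cruxes.ChiralDescent.InfimumDescent.integrable_apply_of_coeffRegular
    ((coeffRegular_prod_ofFn fun i => coeffRegular_renormInsertion sch k (σ i) (x i)).mul
      (coeffRegular_qcdBoltzmann fun fl => sch.mq fl k)) fermiIntegral _

/-- **Weight of the lattice `n`-point distribution**: the honest lattice expectation of the ORDERED product of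
the renormalised centred insertions of the species `σ i` at the sites `x i`,
`W_σ(x) = ∫dμ_W(U) ∫dψ̄dψ (∏ᵢ z_{σᵢ} a⁴ (O_{σᵢ}(xᵢ) − shift_{σᵢ})) e^{−ψ̄D(U)ψ} / ∫dμ_W(U) ∫dψ̄dψ e^{−ψ̄D(U)ψ}`
(signed fermion determinant in numerator and denominator; junk `0` if the denominator vanishes). -/
def qcdTorusMomentStr (sch : QCDScheme Nf) (k : ℕ) {n : ℕ} (σ : Fin n → QCDField Nf)
    (x : Fin n → Site 4) : ℂ :=
  (∫ U, fermiIntegral ((List.ofFn fun i => renormInsertion sch k (σ i) (x i) U).prod *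
      fermiBoltzmann U fun fl => sch.mq fl k) ∂(qcdGaugeMeasure sch k)) /
    ∫ U, fermiIntegral (fermiBoltzmann U fun fl => sch.mq fl k) ∂(qcdGaugeMeasure sch k)

/-- `qcdTorusMomentStr` unfolded to the tree's primitives (the literal formula of the line's brief):
`W_σ(x) = ∫dμ_W ∫dψ̄dψ (∏ᵢ (z_{σᵢ}(k) a_k⁴ : ℂ) • (insertion U (σ i) (x i) − shift_{σᵢ}(k))) e^{−ψ̄Dψ} / ∫dμ_W ∫dψ̄dψ e^{−ψ̄Dψ}`. -/
theorem qcdTorusMomentStr_eq (sch : QCDScheme Nf) (k : ℕ) {n : ℕ} (σ : Fin n → QCDField Nf) (x : Fin n → Site 4) :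
    qcdTorusMomentStr sch k σ x =
      (∫ U, fermiIntegral ((List.ofFn fun i => ((sch.z (σ i) k * sch.a k ^ 4 : ℝ) : ℂ) •
          (insertion U (σ i) (x i) - algebraMap ℂ _ ((sch.shift (σ i) k : ℝ) : ℂ))).prod *
          fermiBoltzmann U fun fl => sch.mq fl k) ∂(qcdGaugeMeasure sch k)) /
        ∫ U, fermiIntegral (fermiBoltzmann U fun fl => sch.mq fl k) ∂(qcdGaugeMeasure sch k) :=
  rfl

/-- **The lattice `n`-point distribution of lattice QCD** for the species string `σ` at step `k`: the finite atomic
continuous linear functional `F ↦ ∑_{x ∈ (box L_k)ⁿ} W_σ(x) F(a_k x)` on `𝓢((Fin n → ℝ⁴), ℂ)` for `n ≥ 1`, and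
point evaluation `F ↦ F(0)` in degree `0` (so that `𝔖₀ = 1` holds exactly, independently of the torus denominator). -/
def qcdLatticeDist (sch : QCDScheme Nf) (k n : ℕ) (σ : Fin n → QCDField Nf) :
    𝓢((Fin n → EuclideanSpace ℝ (Fin 4)), ℂ) →L[ℂ] ℂ :=
  if n = 0 then LabelledSchwingerFamily.evalAt default else
    ∑ x ∈ Fintype.piFinset (fun _ : Fin n => box 4 (sch.L k)),
      qcdTorusMomentStr sch k σ x • LabelledSchwingerFamily.evalAt (fun i => sch.a k • siteToE (x i))

/-- Degree `0`: `qcdLatticeDist sch k 0 σ` is point evaluation. -/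
theorem qcdLatticeDist_zero (sch : QCDScheme Nf) (k : ℕ) (σ : Fin 0 → QCDField Nf) :
    qcdLatticeDist sch k 0 σ = LabelledSchwingerFamily.evalAt default := by
  simp [qcdLatticeDist]

/-- Degree `n ≥ 1`: `qcdLatticeDist sch k n σ = ∑ₓ W_σ(x) • δ_{a_k x}` as a continuous linear functional. -/
theorem qcdLatticeDist_eq_sum (sch : QCDScheme Nf) (k : ℕ) {n : ℕ} (hn : n ≠ 0) (σ : Fin n → QCDField Nf) :
    qcdLatticeDist sch k n σ =
      ∑ x ∈ Fintype.piFinset (fun _ : Fin n => box 4 (sch.L k)),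
        qcdTorusMomentStr sch k σ x • LabelledSchwingerFamily.evalAt (fun i => sch.a k • siteToE (x i)) := by
  rw [qcdLatticeDist, if_neg hn]

/-- Degree `0`: `qcdLatticeDist sch k 0 σ F = F(pt)`. -/
theorem qcdLatticeDist_zero_apply (sch : QCDScheme Nf) (k : ℕ) (σ : Fin 0 → QCDField Nf)
    (F : 𝓢((Fin 0 → EuclideanSpace ℝ (Fin 4)), ℂ)) : qcdLatticeDist sch k 0 σ F = F default := by
  simp [qcdLatticeDist]

/-- Unfolding `qcdLatticeDist` in degree `n ≥ 1`: `qcdLatticeDist … F = ∑ₓ W_σ(x) F(a_k x)`. -/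
theorem qcdLatticeDist_apply (sch : QCDScheme Nf) (k : ℕ) {n : ℕ} (hn : n ≠ 0) (σ : Fin n → QCDField Nf)
    (F : 𝓢((Fin n → EuclideanSpace ℝ (Fin 4)), ℂ)) :
    qcdLatticeDist sch k n σ F =
      ∑ x ∈ Fintype.piFinset (fun _ : Fin n => box 4 (sch.L k)),
        qcdTorusMomentStr sch k σ x * F (fun i => sch.a k • siteToE (x i)) := by
  rw [qcdLatticeDist, if_neg hn]
  simp only [_root_.sum_apply, _root_.smul_apply, LabelledSchwingerFamily.evalAt_apply, smul_eq_mul]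

/-- **`qcdLatticeSchwinger` on real tensors IS `qcdLatticeDist`.**  For every scheme, step `k`, arity `n ≥ 1`, species
string `σ`, real test functions `fᵢ` and every tensor witness `F = ⊗ᵢ fᵢ`:
`qcdLatticeDist sch k n σ F = qcdLatticeSchwinger sch k n σ f`.  Proof: expand the ordered product of the smeared
insertions (finite sums) into the sum over site tuples of ordered products, pull the real test-function values out,
exchange the Berezin integral (linear) and the Bochner integral (integrable terms,
`integrable_fermiIntegral_prod_renormInsertion`) with the finite sum, and divide by the common denominator. -/
theorem qcdLatticeSchwinger_eq_qcdLatticeDist :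
    ∀ {Nf : ℕ} (sch : QCDScheme Nf) (k n : ℕ), n ≠ 0 → ∀ (σ : Fin n → QCDField Nf)
      (f : Fin n → 𝓢(EuclideanSpace ℝ (Fin 4), ℝ)) (F : 𝓢((Fin n → EuclideanSpace ℝ (Fin 4)), ℂ)),
      IsTensorOf F (fun i => ofRealTest (f i)) → qcdLatticeDist sch k n σ F = qcdLatticeSchwinger sch k n σ f := by
  intro Nf sch k n hn σ f F hF
  classical
  -- (a)+(b): pointwise expansion of the ordered product of the smeared insertions
  have hexp : ∀ U : GaugeConfig 4 (sch.side k) (Matrix.specialUnitaryGroup (Fin 3) ℂ),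
      (List.ofFn fun i => smearedInsertion sch k U (σ i) (f i)).prod =
        ∑ x ∈ Fintype.piFinset (fun _ : Fin n => box 4 (sch.L k)),
          (∏ i, ((f i (sch.a k • siteToE (x i)) : ℝ) : ℂ)) •
            (List.ofFn fun i => renormInsertion sch k (σ i) (x i) U).prod := by
    intro U
    simp_rw [smearedInsertion_eq_sum_smul_renormInsertion]
    rw [prod_ofFn_finset_sum]
    exact Finset.sum_congr rfl fun x _ => prod_ofFn_smul _ _
  -- (c): linearity of the Berezin integral
  have hfun : (fun U : GaugeConfig 4 (sch.side k) (Matrix.specialUnitaryGroup (Fin 3) ℂ) =>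
      fermiIntegral ((List.ofFn fun i => smearedInsertion sch k U (σ i) (f i)).prod *
        fermiBoltzmann U fun fl => sch.mq fl k)) =
      fun U => ∑ x ∈ Fintype.piFinset (fun _ : Fin n => box 4 (sch.L k)),
        (∏ i, ((f i (sch.a k • siteToE (x i)) : ℝ) : ℂ)) *
          fermiIntegral ((List.ofFn fun i => renormInsertion sch k (σ i) (x i) U).prod *
            fermiBoltzmann U fun fl => sch.mq fl k) := by
    funext U
    rw [hexp U, Finset.sum_mul, map_sum]
    exact Finset.sum_congr rfl fun x _ => by rw [smul_mul_assoc, map_smul, smul_eq_mul]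
  -- (c'): the Bochner integral commutes with the finite sum (integrable terms), (d): common denominator
  unfold qcdLatticeSchwinger
  rw [hfun, integral_finsetSum _ fun x _ =>
    (integrable_fermiIntegral_prod_renormInsertion sch k σ x).const_mul _]
  simp only [integral_const_mul]
  rw [Finset.sum_div, qcdLatticeDist_apply sch k hn]
  refine Finset.sum_congr rfl fun x _ => ?_
  rw [hF]
  simp only [ofRealTest_apply, qcdTorusMomentStr]
  ring


/-! ## Thermal, Θ-symmetrised twins (line `Sketch`, reshape r3e, lead c16)

The statement's torus functional `qcdTorusExpect` has time-PERIODIC quarks (the `(−1)^F`-twisted trace of Lüscher's transfer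
matrix) and its `glue` representative is the FORWARD Wilson action density (six plaquettes based at the site), which the
Osterwalder–Seiler site reflection `Θ` maps to the BACKWARD density at the reflected site — so the smeared OS forms of the
statement's functional are not manifestly reflection positive at finite `k`.  The r3e package of line `Sketch` is read instead
on the THERMAL functional `qcdTorusExpectAP` (antiperiodic quarks; site-reflection positive: `WilsonQCDSiteReflectionPositivityAP_holds`,
and for arbitrary positive-time torus functions `…StubAbstractThermalRP.stub_abstractThermalRP`) with Θ-SYMMETRISED insertions
`insertionSym U s y = ½ (insertion U s y + Θ (insertion (Θ'U) s (θy)))` — for `glue` the time-symmetrised ("clover in time")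
action density, for the mesons the insertion itself (`…StubMesonReflect.stub_meson_reflect`) — which are Θ-covariant by
construction (`torusTheta_insertionSym`).  The canonical lattice `n`-point distributions of this functional are
`qcdLatticeDistSymAP`; its smeared `n`-point numbers `qcdLatticeSchwingerSymAP` are DEFINED through the canonical tensor
witness (no separate agreement theorem is needed).  References: Osterwalder–Seiler 1978 §2–§3; Lüscher 1977; Montvay–Münster
1994 §4.1.3 (4.34), §4.2.3 (4.90)–(4.111). -/

section SymThermal

variable {L : ℕ} [NeZero L]

/-- **The Θ-symmetrised lattice representative** of species `s` at the site `y ∈ ℤ⁴` (read on the torus of side `L`) in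
the background `U`: the average of the tree's `insertion U s y` and of the site reflection `Θ` (`torusTheta`) of the insertion
at the reflected site `θy` in the reflected background `Θ'U`; for `glue` this is the Wilson action density symmetrised in time
(spatial plaquettes at `y`, temporal plaquettes based at `y` and at `y − ê₀` with weight `½`), for the pseudoscalar mesons it
is the meson itself. [cite: OsterwalderSeiler1978, §2] [cite: MontvayMunster1994, §4.2.3 (4.99)] -/
def insertionSym (U : GaugeConfig 4 L (Matrix.specialUnitaryGroup (Fin 3) ℂ)) (s : QCDField Nf) (y : Site 4) : FermiAlg Nf L :=
  (1 / 2 : ℂ) • (insertion U s y + torusTheta (insertion U.negReflect s (siteReflect y)))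

/-- **Θ-covariance of the symmetrised insertions** (by construction, for every species):
`Θ (insertionSym (Θ'U) s y) = insertionSym U s (θy)` — `Θ` is an antilinear involution and `Θ'`, `θ` are involutions. -/
theorem torusTheta_insertionSym : ∀ {L : ℕ} [NeZero L] (U : GaugeConfig 4 L (Matrix.specialUnitaryGroup (Fin 3) ℂ)) (s : QCDField Nf) (y : Site 4), torusTheta (insertionSym U.negReflect s y) = insertionSym U s (siteReflect y) := by
  intro L _ U s y
  unfold insertionSym
  rw [LinearMap.map_smulₛₗ, map_add, torusTheta_torusTheta, WilsonSiteRP.negReflect_negReflect_config,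
    siteReflect_siteReflect, add_comm]
  congr 1
  rw [map_div₀, map_one, map_ofNat]

/-- **The renormalised, centred, Θ-symmetrised insertion** `z_s(k) a_k⁴ (O^sym_s(y) − shift_s(k))` of the scheme at step `k`. -/
def renormInsertionSym (sch : QCDScheme Nf) (k : ℕ) (s : QCDField Nf) (y : Site 4)
    (U : GaugeConfig 4 (sch.side k) (Matrix.specialUnitaryGroup (Fin 3) ℂ)) : FermiAlg Nf (sch.side k) :=
  ((sch.z s k * sch.a k ^ 4 : ℝ) : ℂ) • (insertionSym U s y - algebraMap ℂ _ ((sch.shift s k : ℝ) : ℂ))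

/-- **Thermal weight of the symmetrised lattice `n`-point distribution**: the THERMAL expectation (`qcdTorusExpectAP`:
antiperiodic quarks, honest trace of the transfer matrix) of the ORDERED product of the renormalised symmetrised insertions of
the species `σ i` at the sites `x i`. [cite: MontvayMunster1994, §4.1.3 (4.34)] [cite: Luscher1977] -/
def qcdTorusMomentSymAP (sch : QCDScheme Nf) (k : ℕ) {n : ℕ} (σ : Fin n → QCDField Nf) (x : Fin n → Site 4) : ℂ :=
  qcdTorusExpectAP (sch.β k) (sch.side k) (fun fl => sch.mq fl k)
    fun U => (List.ofFn fun i => renormInsertionSym sch k (σ i) (x i) U).prod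

/-- **The thermal, Θ-symmetrised lattice `n`-point distribution** of the species string `σ` at step `k`: the finite atomic
continuous linear functional `F ↦ ∑_{x ∈ (box L_k)ⁿ} W^{AP,sym}_σ(x) F(a_k x)` on `𝓢((Fin n → ℝ⁴), ℂ)` for `n ≥ 1`, point
evaluation in degree `0` (twin of `qcdLatticeDist`). [cite: GlimmJaffeQP1987, §6.1] [cite: OsterwalderSchraderCMP1973, §2] -/
def qcdLatticeDistSymAP (sch : QCDScheme Nf) (k n : ℕ) (σ : Fin n → QCDField Nf) :
    𝓢((Fin n → EuclideanSpace ℝ (Fin 4)), ℂ) →L[ℂ] ℂ :=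
  if n = 0 then LabelledSchwingerFamily.evalAt default else
    ∑ x ∈ Fintype.piFinset (fun _ : Fin n => box 4 (sch.L k)),
      qcdTorusMomentSymAP sch k σ x • LabelledSchwingerFamily.evalAt (fun i => sch.a k • siteToE (x i))

/-- Degree `0`: `qcdLatticeDistSymAP sch k 0 σ F = F(pt)`. -/
theorem qcdLatticeDistSymAP_zero_apply (sch : QCDScheme Nf) (k : ℕ) (σ : Fin 0 → QCDField Nf)
    (F : 𝓢((Fin 0 → EuclideanSpace ℝ (Fin 4)), ℂ)) : qcdLatticeDistSymAP sch k 0 σ F = F default := by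
  simp [qcdLatticeDistSymAP]

/-- Degree `n ≥ 1`: `qcdLatticeDistSymAP … F = ∑ₓ W^{AP,sym}_σ(x) F(a_k x)`. -/
theorem qcdLatticeDistSymAP_apply (sch : QCDScheme Nf) (k : ℕ) {n : ℕ} (hn : n ≠ 0) (σ : Fin n → QCDField Nf)
    (F : 𝓢((Fin n → EuclideanSpace ℝ (Fin 4)), ℂ)) :
    qcdLatticeDistSymAP sch k n σ F =
      ∑ x ∈ Fintype.piFinset (fun _ : Fin n => box 4 (sch.L k)),
        qcdTorusMomentSymAP sch k σ x * F (fun i => sch.a k • siteToE (x i)) := by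
  rw [qcdLatticeDistSymAP, if_neg hn]
  simp only [_root_.sum_apply, _root_.smul_apply, LabelledSchwingerFamily.evalAt_apply, smul_eq_mul]

/-- **The thermal, Θ-symmetrised lattice `n`-point FUNCTION** of the species string `σ` on real one-point test functions
`fᵢ`: the distribution `qcdLatticeDistSymAP` read on the canonical tensor witness `⊗ᵢ fᵢ` (`SchwartzMap.tensorFin`) — the
shape `ℕ → (n : ℕ) → (Fin n → ι) → (Fin n → 𝓢(ℝ⁴, ℝ)) → ℂ` consumed by `ClustersCS` / `OSData.hasMassGap_of_clustersCS`.
[cite: JaffeWitten2000, §5] -/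
def qcdLatticeSchwingerSymAP (sch : QCDScheme Nf) (k : ℕ) (n : ℕ) (σ : Fin n → QCDField Nf)
    (f : Fin n → 𝓢(EuclideanSpace ℝ (Fin 4), ℝ)) : ℂ :=
  qcdLatticeDistSymAP sch k n σ (SchwartzMap.tensorFin n fun i => ofRealTest (f i))

/-- `qcdLatticeSchwingerSymAP` IS `qcdLatticeDistSymAP` on every tensor witness of the same real test functions
(tensor witnesses are unique). -/
theorem qcdLatticeSchwingerSymAP_eq (sch : QCDScheme Nf) (k n : ℕ) (σ : Fin n → QCDField Nf)
    (f : Fin n → 𝓢(EuclideanSpace ℝ (Fin 4), ℝ)) (F : 𝓢((Fin n → EuclideanSpace ℝ (Fin 4)), ℂ))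
    (hF : IsTensorOf F fun i => ofRealTest (f i)) :
    qcdLatticeSchwingerSymAP sch k n σ f = qcdLatticeDistSymAP sch k n σ F := by
  unfold qcdLatticeSchwingerSymAP
  rw [(isTensorOf_tensorFin fun i => ofRealTest (f i)).unique hF]

/-- **The smeared, Θ-symmetrised observable of a finite family** of species strings `lab j` (arities `deg j`) and
`n`-point test functions `G j` at step `k`: `X(U) = Σⱼ Σ_{y ∈ (box L_k)^{deg j}} G_j(a_k y) · ∏ₗ (renormalised
symmetrised insertion of `lab j l` at `y l`)` (ordered product).  Its thermal OS pairing `⟨X · ΘX⟩_AP` is the OS form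
`Σᵢⱼ Λ^{AP,sym}(ΘGᵢ* ⊗ Gⱼ)` of the distributions `qcdLatticeDistSymAP`, and it is a positive-time coefficient-regular torus
function when the `G j` live at lattice times `2 ≤ t ≤ L_k − 1` — the two inputs of the exact reflection positivity of the
thermal symmetrised functional. [cite: OsterwalderSeiler1978, §2] [cite: MontvayMunster1994, §4.2.3 (4.90)] -/
def symSmearedObs (sch : QCDScheme Nf) (k : ℕ) {N : ℕ} (deg : Fin N → ℕ) (lab : (j : Fin N) → Fin (deg j) → QCDField Nf)
    (G : (j : Fin N) → 𝓢((Fin (deg j) → EuclideanSpace ℝ (Fin 4)), ℂ))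
    (U : GaugeConfig 4 (sch.side k) (Matrix.specialUnitaryGroup (Fin 3) ℂ)) : FermiAlg Nf (sch.side k) :=
  ∑ j, ∑ y ∈ Fintype.piFinset (fun _ : Fin (deg j) => box 4 (sch.L k)),
    G j (fun l => sch.a k • siteToE (y l)) • (List.ofFn fun l => renormInsertionSym sch k (lab j l) (y l) U).prod

end SymThermal

end Summit.QuantumFields.QCD.Cruxes.StableActionBridge.Sketch

end
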